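import Summits.Ventures.AbcSig.Rows.Bridge
import Summits.Ventures.AbcSig.Rows.C2aL173A45S
import Summits.Ventures.AbcSig.Rows.C2aL173A45SAB

/-!
# Venture AbcSig — CELL `C2aL173A45`: the census statement `Rows.C2aCellRed 173 (fun a => a = 4 ∨ a = 5) ∅` from the two row theorems

S-VARIANT (p-lean g5) of `xcell_C2aL173A45`: kernel sieve discharges replace the cited pair(s) 1384.3 @ 13, 1384.4 @ 11 (see the row files).
HONEST FRAMING. COMPUTATION cell `pub-abcsig`; CONDITIONAL theorem; no claim on ABC or any summit. Hypotheses exactly as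
in `Rows/C2aL173A45X.lean` and `Rows/C2aL173A45XAB.lean`: `BS04Package` (CITED), `DataComplete …` (COMPUTED level files), `EisPackage` (CITED) and `Refines` (COMPUTED) for the M6 orbits discharged in the kernel, and the
rows' per-orbit exclusions for BOTH family predicates (`famB`, `famAB`) as universally quantified hypotheses (CITED: the census
row's certificates). Conclusion = p1's census predicate (`Rows/Statements.lean`), all four coprime coefficient
distributions `A·B = 2^a·173^m`, reduced exponents `a < n`, `m < n` (RULING H1). GENERATED by p-lean g2 gen/make_rows.py
(after plean/make_cell_bridges.py).
-/

namespace Summit.Ventures.AbcSig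

/-- Cell `C2aL173A45` (M6 orbits discharged in the kernel): `Rows.C2aCellRed 173 (fun a => a = 4 ∨ a = 5) ∅` under the rows' hypotheses. -/
theorem xcell_C2aL173A45S (M : NewformModel) (hP : M.BS04Package)
    (hE : M.EisPackage)
    (hD346 : M.DataComplete 346 level346Orbits)
    (hD1384 : M.DataComplete 1384 level1384Orbits)
    (hR_orbit_346_5 : M.Refines 346 orbit_346_5 m6X_346_5)
    (hRB_orbit_1384_3 : ∀ f : M.Form 1384, M.Matches f orbit_1384_3 → M.Matches f rb_1384_3)
    (hRB_orbit_1384_4 : ∀ f : M.Form 1384, M.Matches f orbit_1384_4 → M.Matches f rb_1384_4) :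
    Rows.C2aCellRed 173 (fun a => a = 4 ∨ a = 5) ∅ :=
  C2aCellRed_of_rows 173 (by norm_num) (by norm_num) _ _
    (fun n hn h11 hnℓ _ a m ha han hm hmn x y z h1 h2 =>
      xrow_C2aL173A45S M hP hE hD346 hD1384 hR_orbit_346_5 n hn h11 hnℓ a m ha hm han hmn hRB_orbit_1384_3 hRB_orbit_1384_4 x y z h1 h2)
    (fun n hn h11 hnℓ _ a m ha han hm hmn x y z h1 h2 =>
      xrow_C2aL173A45SAB M hP hE hD346 hD1384 hR_orbit_346_5 n hn h11 hnℓ a m ha hm han hmn hRB_orbit_1384_3 hRB_orbit_1384_4 x y z h1 h2)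

end Summit.Ventures.AbcSig
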